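import Literature.NumberTheory.LFunctions.ApproxFunctionalEquation
import HarnessLib

/-!
# Sharp-ended eta vector at the zeros, I: refined per-frequency estimates for the
# Hardy–Littlewood approximate functional equation (route EtaLeadingQuarter, item
`EtaLeadingSecondMoment`, stmt-RiemannHypothesis-21791)

The tree proves Titchmarsh's Theorem 4.13 on the critical line
(`Literature/NumberTheory/LFunctions/ApproxFunctionalEquation.lean`) with the frequencies nearest
to `y = t/(2πa)` kept at distance `≥ 1/4` by moving the abscissa `a`. For the partial sums
`∑_{n ≤ X} n^{-s}` with `X` FIXED and `t` ranging over the ordinates of the zeros (the use made of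
the approximate functional equation by the eta-vector second moment, BRIEF-L18-K1) the abscissa
cannot be moved, and the two frequencies `ν₀ = [y]`, `ν₁ = [y] + 1` adjacent to `y` need an
estimate valid at every distance. This file proves the per-frequency estimates with a free
boundary-layer parameter `Δ ∈ [0, a/2]`: the integral over `[a - Δ, a]` (resp. `[a, a + Δ]`) is
bounded trivially and the first-derivative test (Titchmarsh, Lemma 4.3, tree
`AFE.norm_integral_near_head_le` / `AFE.norm_integral_far_pos_le`) is applied on the rest, where
the phase derivative is at least `2π(a·dist + νΔ)/u`. With `Δ = 0` these are the estimates of the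
tree's §4.13 proof; with `Δ ≍ √(a/ν)` they give the transition-zone bound `O(ν^{-1/2})`.

* `near_term_split_le` — for `1 ≤ ν ≤ y`:
  `‖∫_a^N u^{-s} e(νu) du − afeCoeff(s) ν^{s-1}‖ ≤ 4N^{-σ}/(πν) + a^{1-σ}/t + Δ(a/2)^{-σ}`
  `+ (2/π) a^{1-σ}/(a(y − ν) + νΔ)`;
* `far_pos_term_split_le` — for `ν > y`:
  `‖s (2πiν)^{-1} ∫_a^N u^{-s-1} e(νu) du‖ ≤ (‖s‖/(2πν)) (Δ a^{-σ-1} + (2/π) a^{-σ}/(a(ν − y) + νΔ))`;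
The sums over the remaining frequencies and the assembled inequality are in part II,
`EtaLeadingQuarterSecondMomentAFESums.lean`.

All statements are RH-free real analysis. Nothing here bears on the truth of RH.

References: E. C. Titchmarsh, *The Theory of the Riemann Zeta-Function*, 2nd ed., §4.13,
Lemma 4.3.
-/

noncomputable section

open Complex MeasureTheory Set Filter intervalIntegral Finset
open scoped Real Topology Interval

set_option linter.dupNamespace false  -- the mandated namespace repeats `RiemannHypothesis`

namespace Summit.RiemannHypothesis.RiemannHypothesis.Theorems.EtaLeadingQuarter.SecondMomentAFE

open Literature.NumberTheory.LFunctions Literature.NumberTheory.LFunctions.AFE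

/-! ## The frequency just below `y`, with a boundary layer -/

/-- **Near frequency with a boundary layer.** For `0 < σ < 1`, `t = Im s = 2πay`, `1 ≤ ν ≤ y`,
`0 ≤ Δ ≤ a/2` with `a(y − ν) + νΔ > 0`, `a ≤ N`, `t ≤ πN`:
`‖∫_a^N u^{-s} e(νu) du − afeCoeff(s) ν^{s-1}‖`
`≤ 4N^{-σ}/(πν) + a^{1-σ}/t + Δ (a/2)^{-σ} + (2/π) a^{1-σ}/(a(y − ν) + νΔ)`.
Proof: `∫_a^N = ∫_0^N − ∫_0^{a−Δ} − ∫_{a−Δ}^a`; the complete integral is `afeCoeff(s) ν^{s-1}`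
up to `4N^{1-σ}/(2πνN − t)` (tree `AFE.norm_integral_cpow_mul_exp_sub_Gamma_le`), the head
`∫_0^{a−Δ}` is bounded by the tree's `AFE.norm_integral_near_head_le` (there the phase derivative
is `≥ 2π(a(y−ν) + νΔ)/u`), and `‖∫_{a−Δ}^a‖ ≤ Δ (a/2)^{-σ}`. [folklore] -/
theorem near_term_split_le {s : ℂ} (hσ0 : 0 < s.re) (hσ1 : s.re < 1) {a y Δ : ℝ} (ha : 0 < a)
    (ht : s.im = 2 * π * a * y) {ν : ℕ} (hν1 : 1 ≤ ν) (hνy : (ν : ℝ) ≤ y) (hΔ0 : 0 ≤ Δ)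
    (hΔa : Δ ≤ a / 2) (hpos : 0 < a * (y - ν) + ν * Δ) {N : ℕ} (haN : a ≤ N)
    (hNt : s.im ≤ π * N) :
    ‖(∫ u in a..N, (u : ℂ) ^ (-s) * Complex.exp (((2 * π * ν * u : ℝ) : ℂ) * I))
        - afeCoeff s * (ν : ℂ) ^ (s - 1)‖
      ≤ 4 * (N : ℝ) ^ (-s.re) / π * (1 / ν) + a ^ (1 - s.re) / s.im
        + Δ * (a / 2) ^ (-s.re) + 2 / π * a ^ (1 - s.re) / (a * (y - ν) + ν * Δ) := by
  have hπ := Real.pi_pos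
  have hνR : (1 : ℝ) ≤ ν := by exact_mod_cast hν1
  have hνpos : (0 : ℝ) < ν := by linarith
  have hy1 : 1 ≤ y := hνR.trans hνy
  have htpos : 0 < s.im := by rw [ht]; positivity
  have hNpos : (0 : ℝ) < N := ha.trans_le haN
  have ht_le : s.im ≤ ‖1 - s‖ := by
    have := Complex.abs_im_le_norm (1 - s)
    simp only [sub_im, one_im, zero_sub, abs_neg] at this
    rwa [abs_of_pos htpos] at this
  have h1s_pos : 0 < ‖1 - s‖ := htpos.trans_le ht_le
  set a' : ℝ := a - Δ with ha'
  have ha'pos : 0 < a' := by rw [ha']; linarith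
  have ha'le : a' ≤ a := by rw [ha']; linarith
  have ha'ge : a / 2 ≤ a' := by rw [ha']; linarith
  have hden : s.im - 2 * π * ν * a' = 2 * π * (a * (y - ν) + ν * Δ) := by rw [ht, ha']; ring
  have hνa' : 2 * π * ν * a' < s.im := by
    have : 0 < s.im - 2 * π * ν * a' := by rw [hden]; positivity
    linarith
  have hlam : (0 : ℝ) < 2 * π * ν := by positivity
  have hNt' : s.im < 2 * π * ν * N := by
    calc s.im ≤ π * N := hNt
      _ < 2 * π * ν * N := by nlinarith
  -- the integrand and the splitting
  set G : ℝ → ℂ := fun u => (u : ℂ) ^ (-s) * Complex.exp (((2 * π * ν * u : ℝ) : ℂ) * I) with hG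
  have hGi : ∀ c d : ℝ, IntervalIntegrable G volume c d := fun c d =>
    (intervalIntegral.intervalIntegrable_cpow' (by simp; linarith)).mul_continuousOn (by fun_prop)
  have hsplit : ∫ u in a..N, G u
      = (∫ u in (0 : ℝ)..N, G u) - (∫ u in (0 : ℝ)..a', G u) - ∫ u in a'..a, G u := by
    rw [← intervalIntegral.integral_add_adjacent_intervals (hGi 0 a') (hGi a' N),
      ← intervalIntegral.integral_add_adjacent_intervals (hGi a' a) (hGi a N)]
    ring
  -- `∫_0^N G = ν^{s-1} afeCoeff s + O(N^{1-σ}/(2πνN - t))`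
  have hE2 := norm_integral_cpow_mul_exp_sub_Gamma_le hσ0 hσ1 htpos.le hlam hNpos hNt'
  have hscale : (1 / (-(2 * π * ν * I))) ^ (1 - s) * Complex.Gamma (1 - s)
      = (ν : ℂ) ^ (s - 1) * afeCoeff s := by
    have := cpow_scale_afeCoeff hνpos s
    simpa using this
  have hlamc : ((2 * π * (ν : ℝ) : ℝ) : ℂ) * I = 2 * π * (ν : ℂ) * I := by push_cast; ring
  rw [hlamc, hscale] at hE2
  -- `‖∫_0^{a'} G‖`
  have hhead := norm_integral_near_head_le hσ0 hσ1 ha'pos.le hνpos hνa'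
  -- `‖∫_{a'}^a G‖ ≤ Δ (a/2)^{-σ}`
  have hlayer : ‖∫ u in a'..a, G u‖ ≤ Δ * (a / 2) ^ (-s.re) := by
    have hb : ∀ u ∈ Ι a' a, ‖G u‖ ≤ (a / 2) ^ (-s.re) := by
      intro u hu
      rw [uIoc_of_le ha'le] at hu
      have hu0 : 0 < u := ha'pos.trans hu.1
      simp only [hG]
      rw [norm_mul, Complex.norm_exp_ofReal_mul_I, mul_one,
        Complex.norm_cpow_eq_rpow_re_of_pos hu0, neg_re]
      exact Real.rpow_le_rpow_of_nonpos (by positivity) (by linarith [hu.1]) (by linarith)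
    have h := intervalIntegral.norm_integral_le_of_norm_le_const hb
    rw [abs_of_nonneg (by linarith : (0 : ℝ) ≤ a - a')] at h
    calc ‖∫ u in a'..a, G u‖ ≤ (a / 2) ^ (-s.re) * (a - a') := h
      _ = Δ * (a / 2) ^ (-s.re) := by rw [ha']; ring
  -- combine
  have hGeq : (fun u : ℝ => (u : ℂ) ^ (-s) * Complex.exp ((((2 * π * ν) * u : ℝ) : ℂ) * I)) = G := by
    funext u; simp only [hG]
  rw [hGeq] at hE2 hhead
  rw [hsplit, show (ν : ℂ) ^ (s - 1) * afeCoeff s = afeCoeff s * (ν : ℂ) ^ (s - 1) by ring] at *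
  have htri : ‖(∫ u in (0 : ℝ)..N, G u) - (∫ u in (0 : ℝ)..a', G u) - (∫ u in a'..a, G u)
        - afeCoeff s * (ν : ℂ) ^ (s - 1)‖
      ≤ ‖(∫ u in (0 : ℝ)..N, G u) - afeCoeff s * (ν : ℂ) ^ (s - 1)‖
        + ‖∫ u in (0 : ℝ)..a', G u‖ + ‖∫ u in a'..a, G u‖ := by
    rw [show (∫ u in (0 : ℝ)..N, G u) - (∫ u in (0 : ℝ)..a', G u) - (∫ u in a'..a, G u)
          - afeCoeff s * (ν : ℂ) ^ (s - 1)
        = ((∫ u in (0 : ℝ)..N, G u) - afeCoeff s * (ν : ℂ) ^ (s - 1)) - (∫ u in (0 : ℝ)..a', G u)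
          - ∫ u in a'..a, G u by ring]
    exact (norm_sub_le _ _).trans (by gcongr; exact norm_sub_le _ _)
  refine htri.trans ?_
  -- the bounds
  have hb1 : 4 * ((N : ℝ) ^ (1 - s.re) / (2 * π * ν * N - s.im))
      ≤ 4 * (N : ℝ) ^ (-s.re) / π * (1 / ν) := by
    have hden1 : π * ν * N ≤ 2 * π * ν * N - s.im := by nlinarith
    have hdenpos : 0 < π * ν * N := by positivity
    calc 4 * ((N : ℝ) ^ (1 - s.re) / (2 * π * ν * N - s.im))
        ≤ 4 * ((N : ℝ) ^ (1 - s.re) / (π * ν * N)) := by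
          gcongr
        _ = 4 * (N : ℝ) ^ (-s.re) / π * (1 / ν) := by
          rw [show (1 : ℝ) - s.re = -s.re + 1 by ring, Real.rpow_add hNpos, Real.rpow_one]
          field_simp
  have hb2 : a' ^ (1 - s.re) / ‖1 - s‖ ≤ a ^ (1 - s.re) / s.im := by
    have h1 : a' ^ (1 - s.re) ≤ a ^ (1 - s.re) :=
      Real.rpow_le_rpow ha'pos.le ha'le (by linarith)
    calc a' ^ (1 - s.re) / ‖1 - s‖ ≤ a ^ (1 - s.re) / ‖1 - s‖ := by gcongr
      _ ≤ a ^ (1 - s.re) / s.im := div_le_div_of_nonneg_left (by positivity) htpos ht_le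
  have hb3 : 2 * π * ν / ‖1 - s‖ * (4 * (a' ^ (2 - s.re) / (s.im - 2 * π * ν * a')))
      ≤ 2 / π * a ^ (1 - s.re) / (a * (y - ν) + ν * Δ) := by
    rw [hden]
    have hD : 0 < a * (y - ν) + ν * Δ := hpos
    have e2 : a' ^ (2 - s.re) ≤ a ^ (2 - s.re) :=
      Real.rpow_le_rpow ha'pos.le ha'le (by linarith)
    have e3 : a ^ (2 - s.re) = a ^ (1 - s.re) * a := by
      rw [show (2 : ℝ) - s.re = (1 - s.re) + 1 by ring, Real.rpow_add ha, Real.rpow_one]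
    have hapos : 0 < a ^ (1 - s.re) := Real.rpow_pos_of_pos ha _
    calc 2 * π * ν / ‖1 - s‖ * (4 * (a' ^ (2 - s.re) / (2 * π * (a * (y - ν) + ν * Δ))))
        ≤ 2 * π * ν / s.im * (4 * (a ^ (2 - s.re) / (2 * π * (a * (y - ν) + ν * Δ)))) := by
          gcongr
      _ = 4 * ν * (a ^ (1 - s.re) * a) / (s.im * (a * (y - ν) + ν * Δ)) := by
          rw [e3]; field_simp
      _ ≤ 4 * y * (a ^ (1 - s.re) * a) / (s.im * (a * (y - ν) + ν * Δ)) := by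
          gcongr
      _ = 2 / π * a ^ (1 - s.re) / (a * (y - ν) + ν * Δ) := by
          rw [ht]; field_simp; norm_num
  linarith [hE2, hhead, hlayer, hb1, hb2, hb3]

/-- **Near frequency, generic form** (`Δ = 0`): for `1 ≤ ν < y`,
`‖∫_a^N u^{-s} e(νu) du − afeCoeff(s) ν^{s-1}‖ ≤ 4N^{-σ}/(πν) + a^{1-σ}/t + (2/π) a^{-σ}/(y − ν)`
(the per-frequency estimate of the tree's `AFE.norm_sum_near_sub_le`, without its hypothesis on
the fractional part of `y`). [folklore] -/
theorem near_term_le {s : ℂ} (hσ0 : 0 < s.re) (hσ1 : s.re < 1) {a y : ℝ} (ha : 0 < a)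
    (ht : s.im = 2 * π * a * y) {ν : ℕ} (hν1 : 1 ≤ ν) (hνy : (ν : ℝ) < y) {N : ℕ} (haN : a ≤ N)
    (hNt : s.im ≤ π * N) :
    ‖(∫ u in a..N, (u : ℂ) ^ (-s) * Complex.exp (((2 * π * ν * u : ℝ) : ℂ) * I))
        - afeCoeff s * (ν : ℂ) ^ (s - 1)‖
      ≤ 4 * (N : ℝ) ^ (-s.re) / π * (1 / ν) + a ^ (1 - s.re) / s.im
        + 2 / π * a ^ (-s.re) / (y - ν) := by
  have hyν : 0 < y - ν := by linarith
  have hpos : 0 < a * (y - ν) + ν * 0 := by rw [mul_zero, add_zero]; positivity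
  have h := near_term_split_le hσ0 hσ1 ha ht hν1 hνy.le le_rfl (by linarith) hpos haN hNt
  have e : 2 / π * a ^ (1 - s.re) / (a * (y - ν) + ν * 0) = 2 / π * a ^ (-s.re) / (y - ν) := by
    rw [mul_zero, add_zero, show (1 : ℝ) - s.re = -s.re + 1 by ring, Real.rpow_add ha,
      Real.rpow_one]
    field_simp
  rw [e, zero_mul, add_zero] at h
  exact h

/-! ## The frequency just above `y`, with a boundary layer -/

/-- **Far frequency with a boundary layer.** For `0 < σ`, `t = Im s = 2πay`, `ν > y`, `ν ≥ 1`,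
`0 ≤ Δ`, `a + Δ ≤ N`, with `a(ν − y) + νΔ > 0`:
`‖s (2πiν)^{-1} ∫_a^N u^{-s-1} e(νu) du‖ ≤ (‖s‖/(2πν)) (Δ a^{-σ-1} + (2/π) a^{-σ}/(a(ν − y) + νΔ))`
(trivial bound on `[a, a+Δ]`, the tree's `AFE.norm_integral_far_pos_le` on `[a+Δ, N]`).
[folklore] -/
theorem far_pos_term_split_le {s : ℂ} (hσ : 0 < s.re) {a y Δ : ℝ} (ha : 0 < a)
    (ht : s.im = 2 * π * a * y) {ν : ℕ} (hν1 : 1 ≤ ν) (hΔ0 : 0 ≤ Δ)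
    (hpos : 0 < a * (ν - y) + ν * Δ) {N : ℕ} (haN : a + Δ ≤ N) :
    ‖s * ((1 / (2 * π * I * ν))
        * ∫ u in a..N, (u : ℂ) ^ (-s - 1) * Complex.exp (((2 * π * ν * u : ℝ) : ℂ) * I))‖
      ≤ ‖s‖ / (2 * π * ν) * (Δ * a ^ (-s.re - 1) + 2 / π * a ^ (-s.re) / (a * (ν - y) + ν * Δ)) := by
  have hπ := Real.pi_pos
  have hνR : (1 : ℝ) ≤ ν := by exact_mod_cast hν1
  have hνpos : (0 : ℝ) < ν := by linarith
  set b : ℝ := a + Δ with hb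
  have hab : a ≤ b := by rw [hb]; linarith
  have hbpos : 0 < b := ha.trans_le hab
  have hden : 2 * π * ν * b - s.im = 2 * π * (a * (ν - y) + ν * Δ) := by rw [ht, hb]; ring
  have hνb : s.im < 2 * π * ν * b := by
    have : 0 < 2 * π * ν * b - s.im := by rw [hden]; positivity
    linarith
  set F : ℝ → ℂ := fun u => (u : ℂ) ^ (-s - 1) * Complex.exp (((2 * π * ν * u : ℝ) : ℂ) * I)
    with hF
  have hFi : ∀ c d : ℝ, 0 < c → 0 < d → IntervalIntegrable F volume c d := by
    intro c d hc hd
    refine ContinuousOn.intervalIntegrable ?_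
    intro u hu
    have hu0 : 0 < u := by
      rcases le_total c d with h | h
      · rw [uIcc_of_le h] at hu; exact hc.trans_le hu.1
      · rw [uIcc_of_ge h] at hu; exact hd.trans_le hu.1
    have h1 : ContinuousAt (fun u : ℝ => (u : ℂ) ^ (-s - 1)) u :=
      (continuousAt_ofReal_cpow_const u (-s - 1) (Or.inr hu0.ne')).comp' continuousAt_id
    exact (h1.mul (by fun_prop)).continuousWithinAt
  have hsplit : ∫ u in a..N, F u = (∫ u in a..b, F u) + ∫ u in b..N, F u :=
    (intervalIntegral.integral_add_adjacent_intervals (hFi a b ha hbpos)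
      (hFi b N hbpos (hbpos.trans_le haN))).symm
  -- the layer `[a, a+Δ]`
  have hlayer : ‖∫ u in a..b, F u‖ ≤ Δ * a ^ (-s.re - 1) := by
    have hbd : ∀ u ∈ Ι a b, ‖F u‖ ≤ a ^ (-s.re - 1) := by
      intro u hu
      rw [uIoc_of_le hab] at hu
      have hu0 : 0 < u := ha.trans hu.1
      simp only [hF]
      rw [norm_mul, Complex.norm_exp_ofReal_mul_I, mul_one,
        Complex.norm_cpow_eq_rpow_re_of_pos hu0]
      simp only [sub_re, neg_re, one_re]
      exact Real.rpow_le_rpow_of_nonpos ha hu.1.le (by linarith)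
    have h := intervalIntegral.norm_integral_le_of_norm_le_const hbd
    rw [abs_of_nonneg (by linarith : (0 : ℝ) ≤ b - a)] at h
    calc ‖∫ u in a..b, F u‖ ≤ a ^ (-s.re - 1) * (b - a) := h
      _ = Δ * a ^ (-s.re - 1) := by rw [hb]; ring
  -- the rest `[a+Δ, N]`
  have hrest : ‖∫ u in b..N, F u‖ ≤ 2 / π * a ^ (-s.re) / (a * (ν - y) + ν * Δ) := by
    have h := norm_integral_far_pos_le hσ hbpos (hbpos.le.trans haN |> fun h' => haN) hνpos hνb
    rw [hden] at h
    have hbσ : b ^ (-s.re) ≤ a ^ (-s.re) := Real.rpow_le_rpow_of_nonpos ha hab (by linarith)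
    calc ‖∫ u in b..N, F u‖ ≤ 4 * (b ^ (-s.re) / (2 * π * (a * (ν - y) + ν * Δ))) := h
      _ ≤ 4 * (a ^ (-s.re) / (2 * π * (a * (ν - y) + ν * Δ))) := by gcongr
      _ = 2 / π * a ^ (-s.re) / (a * (ν - y) + ν * Δ) := by field_simp; ring
  rw [norm_mul, norm_mul, norm_one_div_two_pi_I_mul_nat hνpos, hsplit]
  have htri := norm_add_le (∫ u in a..b, F u) (∫ u in b..N, F u)
  have h0 : 0 ≤ ‖s‖ * (1 / (2 * π * ν)) := by positivity
  calc ‖s‖ * (1 / (2 * π * ν) * ‖(∫ u in a..b, F u) + ∫ u in b..N, F u‖)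
      = ‖s‖ * (1 / (2 * π * ν)) * ‖(∫ u in a..b, F u) + ∫ u in b..N, F u‖ := by ring
    _ ≤ ‖s‖ * (1 / (2 * π * ν)) * (Δ * a ^ (-s.re - 1)
        + 2 / π * a ^ (-s.re) / (a * (ν - y) + ν * Δ)) :=
        mul_le_mul_of_nonneg_left (htri.trans (add_le_add hlayer hrest)) h0
    _ = ‖s‖ / (2 * π * ν) * (Δ * a ^ (-s.re - 1)
        + 2 / π * a ^ (-s.re) / (a * (ν - y) + ν * Δ)) := by ring

end Summit.RiemannHypothesis.RiemannHypothesis.Theorems.EtaLeadingQuarter.SecondMomentAFE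

end
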